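import Literature.NumberTheory.Sieve.FGKMT2018SievingPrimes
import Literature.NumberTheory.Sieve.SingularSeries
import Literature.Combinatorics.Hypergraph.FGKMTProbabilisticCovering
import HarnessLib

/-!
# Ford–Green–Konyagin–Maynard–Tao 2018, §4.3 and §6: the random construction (Theorem 4),
# the specialised covering corollary (Corollary 3) and the good sieve weight (Theorem 5) —
# STATEMENTS

Topic `Literature/NumberTheory/Sieve`. Source: K. Ford, B. Green, S. Konyagin, J. Maynard, T. Tao,
*Long gaps between primes*, J. Amer. Math. Soc. 31 (2018) 65–105 = arXiv:1412.5029
[FordGreenKonyaginMaynardTao2018], §4.3 «Applying the covering theorem» (Corollary 3, Theorem 4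
(Random construction), and the deduction of Theorem 2 from them, pp. 11–13) and §6 «Using a sieve
weight» (Theorem 5 (Existence of good sieve weight), p. 17).

This file TYPES the three remaining interfaces of the paper's chain
`Theorem 1 ⇐ (1.2) ⇐ Theorem 2 ⇐ {Corollary 3, Theorem 4} ⇐ {Theorem 3, Theorem 5} ⇐ Theorem 6`
(the first two edges are proved in `LargeGapsCoveringTransfer` and `FGKMT2018SievingPrimes`;
Theorem 3 is typed in `Literature.Combinatorics.Hypergraph.FGKMTProbabilisticCovering`). Nothing is
proved here; the three `def … : Prop` below are NAMED STATEMENTS: `FGKMT2018_corollary3` and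
`FordGreenKonyaginMaynardTao2018_theorem4` are intermediate nodes (kernel targets: Corollary 3 from
Theorem 3 by Hoeffding's inequality and the `P_j`-numerics of p. 12; Theorem 4 from Theorem 5 by
§6), `FordGreenKonyaginMaynardTao2018_theorem5` is the analytic input of the chain (proved in §§7–8
of the paper from the uniform multidimensional sieve, Theorem 6).

RENDERING DECISIONS.
* Corollary 3 is typed in the FIRST-MOMENT form that the proof of Theorem 2 consumes (p. 13: an upper
  bound `≪ x / log x` for the sifted set is all that is used; the paper's `∼` with probability
  `1 − o(1)` — a second-moment refinement needed only in the sequel on chains of gaps — is dropped,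
  and with it the lower bound `#𝒬' > (log₂ x)³`). As in Theorem 3, random edges are LAWS
  `μ i : Finset V → ℝ` on a finite vertex type `V` indexed by a finite type `ι` (`#ι ≤ x` renders
  `#𝒫' ≤ x`; the harmless size bound `#V ≤ x²`, implicit in the paper's union bound, is explicit), the
  exceptional vertices of (4.22) are assumed already discarded («we may discard these elements from
  `𝒬'`», first line of the proof), and the conclusion is a DETERMINISTIC choice of edges `ω i`, each
  empty or of positive `μ i`-mass, leaving `≤ K 5^{-m} #V` vertices uncovered.
* Theorem 4 is typed in the DETERMINISTIC-IN-`a⃗` form in which it is used on p. 13 («Suppose that we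
  are in the probability `1 − o(1)` event that `a⃗` takes a value which is good and such that (4.27)
  holds. Fix some `a⃗` within this event … for the random variables `𝐧_p` conditioned to `𝐚⃗ = a⃗`»):
  there EXIST residue classes `a = (a_s)_{s ∈ 𝒮}` and, for each `p ∈ 𝒫`, a law `ν p` of the integer
  `n_p` (the conditional law), such that (4.26) sparsity, the upper half of (4.27) (with the explicit
  constant `100 ≥ (1 + o(1)) · 80`) and goodness (4.28) hold. The probabilistic formulation of the
  paper implies this one trivially (an event of probability `1 − o(1) > 0` is non-empty), and §6
  proves the probabilistic one. `C ≍ 1/c` «with implied constants independent of `c`» is rendered by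
  absolute constants `C₁ ≤ C₂` quantified before `c`.
* Theorem 5 is typed as printed, with the paper's conventions made explicit (§2: implied constants
  are absolute unless indicated; here they are allowed to depend on `c`, on the range constant `K'`
  of «`h = O(y/x)`» and on the `ε` of the `o(1)`-exponents — a weakening that the deduction of
  Theorem 4 in §6 tolerates, since only the decay `K / log₂^{10} x → 0` and a fixed small `ε` are
  used there): `u = u(r)` «depending only on `r`» is a function `u : ℕ → ℝ` fixed in advance with
  `u(r) ≍ log r`; `τ ≥ x^{-o(1)}` is `∀ ε > 0, eventually τ ≥ x^{-ε}`; `w(p, n) = O(x^{1/3 + o(1)})` is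
  `eventually w(p, n) ≤ x^{1/3 + ε}`; the admissible `r`-tuple `(h_1, …, h_r) ⊆ [2r²]` is an
  admissible finite set `H ⊆ [1, 2 (#H)²]` of integers (`Literature.NumberTheory.Sieve.IsAdmissibleTuple`) with
  `r = #H`; sums over `n ∈ ℤ` of the weight, supported on `|n| ≤ y`, are finite sums over the window
  `[-⌊y⌋, ⌊y⌋]` (`FGKMT2018.weightWindow`). The asymptotic parameter `x` is a natural number, as in
  `FGKMT2018SievingPrimes` (`y = FGKMT2018.ySieve c x`, `𝒫 = FGKMT2018.primesHalf x`,
  `𝒬 = FGKMT2018.primesQ c x`, `𝒮 = FGKMT2018.primesS x`).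

## Main statements
* `FGKMT2018.sievedQ`, `FGKMT2018.edge`, `FGKMT2018.probInEdge` — `𝒬 ∩ S(a⃗)`, the edge
  `e_p = {n_p + h p : h ∈ H} ∩ 𝒬 ∩ S(a⃗)` and `P(q ∈ 𝐞_p)` under the law of `n_p`
  [cite: FordGreenKonyaginMaynardTao2018, Thm 4].
* `FGKMT2018_corollary3` — Corollary 3, first-moment form [cite: FordGreenKonyaginMaynardTao2018, Cor 3].
* `FordGreenKonyaginMaynardTao2018_theorem4` — Theorem 4 (Random construction), deterministic-in-`a⃗`
  form [cite: FordGreenKonyaginMaynardTao2018, Thm 4].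
* `FGKMT2018.weightWindow`, `FordGreenKonyaginMaynardTao2018_theorem5` — Theorem 5 (Existence of
  good sieve weight) [cite: FordGreenKonyaginMaynardTao2018, Thm 5].
-/

open Finset Filter

namespace Literature.NumberTheory.Sieve

namespace FGKMT2018

/-- `𝒬 ∩ S(a⃗)`: the primes of `𝒬 = 𝒬(c, x)` not lying in any of the classes `a_s mod s`, `s ∈ 𝒮`
[cite: FordGreenKonyaginMaynardTao2018, Thm 4 and (3.6)]. -/
noncomputable def sievedQ (c : ℝ) (x : ℕ) (a : ℕ → ℕ) : Finset ℕ :=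
  (primesQ c x).filter (fun q => ∀ s ∈ primesS x, ¬ q ≡ a s [MOD s])

/-- The edge `e_p(a⃗; n) := {n + h p : h ∈ H} ∩ 𝒬 ∩ S(a⃗)` attached to the prime `p` when `n_p = n`
[cite: FordGreenKonyaginMaynardTao2018, Thm 4 (4.26)]. -/
noncomputable def edge (c : ℝ) (x : ℕ) (a : ℕ → ℕ) (H : Finset ℤ) (p : ℕ) (n : ℤ) : Finset ℕ :=
  (sievedQ c x a).filter (fun q => ∃ h ∈ H, (q : ℤ) = n + h * p)

/-- `P(q ∈ 𝐞_p(a⃗))` when `n_p` has the law `ν p` supported in the finite window `N ⊆ ℤ`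
[cite: FordGreenKonyaginMaynardTao2018, Thm 4 (4.28)]. -/
noncomputable def probInEdge (c : ℝ) (x : ℕ) (a : ℕ → ℕ) (H : Finset ℤ) (N : Finset ℤ)
    (ν : ℕ → ℤ → ℝ) (p q : ℕ) : ℝ :=
  ∑ n ∈ N.filter (fun n => q ∈ edge c x a H p n), ν p n

/-- The window `[-⌊y⌋, ⌊y⌋] ⊆ ℤ` carrying the support of the sieve weight `w(p, ·)`
[cite: FordGreenKonyaginMaynardTao2018, Thm 5]. -/
noncomputable def weightWindow (c : ℝ) (x : ℕ) : Finset ℤ :=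
  Finset.Icc (-(⌊ySieve c x⌋₊ : ℤ)) (⌊ySieve c x⌋₊ : ℤ)

end FGKMT2018

open FGKMT2018 Literature.Combinatorics.Hypergraph Literature.Combinatorics.Hypergraph.FGKMTCovering

/-- **Corollary 3** of [FordGreenKonyaginMaynardTao2018, §4.3] in first-moment form. Let `x → ∞`;
let the finite index type `ι` («`𝒫'`») have `#ι ≤ x` and the finite vertex type `V` («`𝒬'`») have
`#V ≤ x²`; for each `i` let `μ i` be the law of a random subset `𝐞_i` of `V` whose sets of positive
mass have `≤ r` elements, `1 ≤ r ≤ K₀ log x log₃ x / log₂² x` (4.21). Assume sparsity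
`P(v ∈ 𝐞_i) ≤ x^{-1/2-1/10}` (4.20), uniform covering `∑_i P(v ∈ 𝐞_i) = C + O_≤(1/(log₂ x)²)` for
EVERY `v` (4.22) with `(5/4) log 5 ≤ C ≤ C_max` (4.23), and small codegrees
`∑_i P(v₁, v₂ ∈ 𝐞_i) ≤ x^{-1/20}` (4.24). Then for every `m ≤ log₃ x / log 5` (4.25) there are edges
`ω i`, each empty or of positive `μ i`-mass, such that
`#{v : v ∉ ω i for all i} ≤ K 5^{-m} #V`, the constant `K` and the threshold in `x` depending only
on `K₀, C_max`. (Kernel target: from `FGKMT2018_theorem3` via a discretised Hoeffding inequality for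
the random level assignment and `FGKMTCovering.exists_config_of_theorem3With`.)
[cite: FordGreenKonyaginMaynardTao2018, Cor 3] -/
def FGKMT2018_corollary3 : Prop :=
  ∀ K₀ Cmax : ℝ, 0 < K₀ → 0 < Cmax → ∃ K : ℝ, 0 < K ∧ ∀ᶠ x : ℕ in atTop,
    ∀ (V ι : Type) [Fintype V] [DecidableEq V] [Fintype ι] [DecidableEq ι]
      (r C : ℝ) (m : ℕ) (μ : ι → Finset V → ℝ),
      (Fintype.card ι : ℝ) ≤ x → (Fintype.card V : ℝ) ≤ (x : ℝ) ^ 2 →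
      1 ≤ r → r ≤ K₀ * (Real.log x * Real.log^[3] x / (Real.log^[2] x) ^ 2) →
      5 / 4 * Real.log 5 ≤ C → C ≤ Cmax → (m : ℝ) ≤ Real.log^[3] x / Real.log 5 →
      (∀ i, IsLaw (μ i)) →
      (∀ i S, μ i S ≠ 0 → (S.card : ℝ) ≤ r) →
      (∀ i v, probMem (μ i) v ≤ (x : ℝ) ^ (-(3 / 5 : ℝ))) →
      (∀ v, |∑ i, probMem (μ i) v - C| ≤ 1 / (Real.log^[2] x) ^ 2) →
      (∀ v₁ v₂, v₁ ≠ v₂ → ∑ i, probPairMem (μ i) v₁ v₂ ≤ (x : ℝ) ^ (-(1 / 20 : ℝ))) →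
      ∃ ω : ι → Finset V, (∀ i, ω i = ∅ ∨ μ i (ω i) ≠ 0) ∧
        (#(univ.filter (fun v => ∀ i, v ∉ ω i)) : ℝ) ≤ K / 5 ^ m * Fintype.card V

/-- **Theorem 4 (Random construction)** of [FordGreenKonyaginMaynardTao2018], in the
deterministic-in-`a⃗` form used in the deduction of Theorem 2 (p. 13). There are absolute constants
`0 < C₁ ≤ C₂` such that for every fixed `0 < c ≤ 1` and all large `x` (with `y = y(c, x)` as in
(3.1)) there are: a quantity `C` with `C₁ / c ≤ C ≤ C₂ / c` (4.29); a finite set `H` of integer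
shifts with `#H ≤ √(log x)`; residue classes `a = (a_s mod s)_{s ∈ 𝒮}` (a good value of `𝐚⃗` inside
the event (4.27)); and for each `p ∈ 𝒫` a law `ν p` for the integer `n_p`, supported in a finite
window `N`, such that, with `e_p = {n_p + h p : h ∈ H} ∩ 𝒬 ∩ S(a⃗)`:
sparsity `P(q ∈ 𝐞_p) ≤ x^{-1/2-1/10}` for `p ∈ 𝒫`, `q ∈ 𝒬 ∩ S(a⃗)` (4.26);
`#(𝒬 ∩ S(a⃗)) ≤ 100 c x log₂ x / log x` (upper half of (4.27));
goodness (4.28): for all but at most `x / (log x log₂ x)` elements `q ∈ 𝒬 ∩ S(a⃗)`,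
`∑_{p ∈ 𝒫} P(q ∈ 𝐞_p) = C + O_≤(1/(log₂ x)²)`. [cite: FordGreenKonyaginMaynardTao2018, Thm 4] -/
def FordGreenKonyaginMaynardTao2018_theorem4 : Prop :=
  ∃ C₁ C₂ : ℝ, 0 < C₁ ∧ C₁ ≤ C₂ ∧ ∀ c : ℝ, 0 < c → c ≤ 1 →
    ∀ᶠ x : ℕ in atTop, ∃ C : ℝ, C₁ / c ≤ C ∧ C ≤ C₂ / c ∧
      ∃ (H : Finset ℤ) (a : ℕ → ℕ) (N : Finset ℤ) (ν : ℕ → ℤ → ℝ),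
        (H.card : ℝ) ≤ Real.sqrt (Real.log x) ∧
        (∀ p ∈ primesHalf x,
          (∀ n, 0 ≤ ν p n) ∧ (∀ n, n ∉ N → ν p n = 0) ∧ ∑ n ∈ N, ν p n = 1) ∧
        (∀ p ∈ primesHalf x, ∀ q ∈ sievedQ c x a,
          probInEdge c x a H N ν p q ≤ (x : ℝ) ^ (-(3 / 5 : ℝ))) ∧
        ((#(sievedQ c x a) : ℝ) ≤ 100 * c * ((x : ℝ) * Real.log^[2] x / Real.log x)) ∧
        ∃ E : Finset ℕ, E ⊆ sievedQ c x a ∧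
          (#E : ℝ) ≤ (x : ℝ) / (Real.log x * Real.log^[2] x) ∧
          ∀ q ∈ sievedQ c x a, q ∉ E →
            |∑ p ∈ primesHalf x, probInEdge c x a H N ν p q - C| ≤ 1 / (Real.log^[2] x) ^ 2

/-- **Theorem 5 (Existence of good sieve weight)** of [FordGreenKonyaginMaynardTao2018, §6]. There
are a function `u = u(r)` of `r` alone with `u(r) ≍ log r` (6.2′) and a threshold `r₀` such that:
for every fixed `0 < c ≤ 1`, every range constant `K'` and every `ε > 0` there is a constant `K`
with, for all large `x` (natural), `y = c x log x log₃ x / log₂ x` (3.1), `𝒫, 𝒬` as in (3.4)–(3.5):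
for every admissible set `H` of `r` integers, `r₀ ≤ r ≤ log^{1/5} x` (6.1), `H ⊆ [1, 2r²]`, there
are `τ ≥ x^{-ε}` (6.2) and a non-negative weight `w : 𝒫 × ℤ → ℝ` supported on `𝒫 × [-y, y]` with
(6.3) `∑_n w(p, n) = (1 + O_≤(K / log₂^{10} x)) τ y / log^r x` for every `p ∈ 𝒫`;
(6.4) `∑_{p ∈ 𝒫} w(p, q - h p) = (1 + O_≤(K / log₂^{10} x)) τ (u/r) x / (2 log^r x)` for every
`q ∈ 𝒬`, `h ∈ H`;
(6.5) `∑_{q ∈ 𝒬} ∑_{p ∈ 𝒫} w(p, q - h p) ≤ (K / log₂^{10} x) τ (x / log^r x) (y / log x)` for every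
integer `h ∉ H` with `|h| ≤ K' y / x`;
(6.6) `w(p, n) ≤ x^{1/3 + ε}`. [cite: FordGreenKonyaginMaynardTao2018, Thm 5] -/
def FordGreenKonyaginMaynardTao2018_theorem5 : Prop :=
  ∃ (u : ℕ → ℝ) (r₀ : ℕ) (u₁ u₂ : ℝ), 0 < u₁ ∧ u₁ ≤ u₂ ∧
    (∀ r : ℕ, r₀ ≤ r → u₁ * Real.log r ≤ u r ∧ u r ≤ u₂ * Real.log r) ∧
    ∀ c : ℝ, 0 < c → c ≤ 1 → ∀ K' : ℝ, 0 < K' → ∀ ε : ℝ, 0 < ε → ∃ K : ℝ, 0 < K ∧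
      ∀ᶠ x : ℕ in atTop, ∀ H : Finset ℤ, IsAdmissibleTuple H → r₀ ≤ #H →
        (#H : ℝ) ≤ (Real.log x) ^ ((1 : ℝ) / 5) → (∀ h ∈ H, 1 ≤ h ∧ h ≤ 2 * (#H : ℤ) ^ 2) →
        ∃ τ : ℝ, (x : ℝ) ^ (-ε) ≤ τ ∧ ∃ w : ℕ → ℤ → ℝ,
          (∀ p n, 0 ≤ w p n) ∧
          (∀ p n, w p n ≠ 0 → p ∈ primesHalf x ∧ |(n : ℝ)| ≤ ySieve c x) ∧
          (∀ p ∈ primesHalf x,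
            |∑ n ∈ weightWindow c x, w p n - τ * ySieve c x / Real.log x ^ #H|
              ≤ K / (Real.log^[2] x) ^ 10 * (τ * ySieve c x / Real.log x ^ #H)) ∧
          (∀ q ∈ primesQ c x, ∀ h ∈ H,
            |∑ p ∈ primesHalf x, w p ((q : ℤ) - h * p)
                - τ * (u #H / #H) * ((x : ℝ) / (2 * Real.log x ^ #H))|
              ≤ K / (Real.log^[2] x) ^ 10 * (τ * (u #H / #H) * ((x : ℝ) / (2 * Real.log x ^ #H)))) ∧
          (∀ h : ℤ, |(h : ℝ)| ≤ K' * ySieve c x / x → h ∉ H →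
            ∑ q ∈ primesQ c x, ∑ p ∈ primesHalf x, w p ((q : ℤ) - h * p)
              ≤ K / (Real.log^[2] x) ^ 10 * (τ * ((x : ℝ) / Real.log x ^ #H)
                  * (ySieve c x / Real.log x))) ∧
          (∀ p n, w p n ≤ (x : ℝ) ^ (1 / 3 + ε : ℝ))

end Literature.NumberTheory.Sieve
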